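import Summits.KontsevichZagierPeriods.Zeta5Search.Certificates.RayC1Decay
import Summits.KontsevichZagierPeriods.Zeta5Search.Certificates.RayC1GrowthSharp
import HarnessLib

/-!
# ζ(5) search — certificates: the ray RayC1 — effective exponent with the SHARP growth constant
(cell `pub-zeta5`, P1 g11)

HONEST FRAMING: systematic search; no irrationality claim unless certified. An effective exponent `γ < 1` is a calibration of
explicit approximations; nothing here concerns the arithmetic nature of `ζ(5)`.

OUR work (Summit side). `RayC1Decay.c1_exponent` with the lower growth constant `182.9135` (integer lattice point) replaced by
`182.9374` (`RayC1GrowthSharp.eventually_exp_le_abs_c1Q_sharp`, floor lattice point): **`c1_exponent_sharp`** — (HD) ⇒ every `γ ≥ 0` with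
`γ(λ + 182.9376) < 182.9374 + 69.1961` is an effective exponent; the tie with `0.86597135` moves to `λ* = 108.219`; instances.
-/

noncomputable section

open Finset Real Filter Topology

namespace Summit.KontsevichZagierPeriods.Zeta5Search.RayC1

open Summit.KontsevichZagierPeriods.Zeta5Search.DualSeries
open Summit.KontsevichZagierPeriods.Zeta5Search.WedgeDictionary
open Summit.KontsevichZagierPeriods.Zeta5Search.RecordRay (abs_sub_div_lt_of_bounds)
open Literature.NumberTheory.Transcendental (zetaValue)

/-! ### The effective exponent -/

/-- **The ray's effective exponent, sharp growth floor.** PROVED here: the form identity, the growth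
`e^{(182.9374−ε)n} ≤ |Q(a·n)| ≤ e^{(182.9376+ε)n}` (lower constant from `RayC1GrowthSharp.eventually_exp_le_abs_c1Q_sharp`,
floor lattice point) and the decay `|L_n| ≤ e^{(-69.1961+ε)n}`. HYPOTHESIS (HD): denominators `D_n` with `D_nP_n ∈ ℤ`,
`0 < D_n ≤ e^{λn}` eventually. CONCLUSION: for every `γ ≥ 0` with `γ(λ + 182.9376) < 182.9374 + 69.1961`, eventually there are integers
`p_n = D_nP_n`, `q_n = D_n|Q(a·n)| ≥ 1` with `|ζ(5) − P_n/Q(a·n)| < 1/q_n^γ`. -/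
theorem c1_exponent_sharp {lam γ : ℝ} (D : ℕ → ℕ)
    (hD : ∀ᶠ n : ℕ in atTop, 0 < D n ∧ (∃ z : ℤ, (D n : ℚ) * c1P n = z) ∧ (D n : ℝ) ≤ Real.exp (lam * n))
    (hγ : 0 ≤ γ) (hrate : γ * (lam + 114336 / 625) < 914687 / 5000 - (-691961 / 10000)) :
    ∀ᶠ n : ℕ in atTop, ∃ p : ℤ, ∃ q : ℕ, 1 ≤ q ∧ (q : ℤ) = D n * |c1Q n| ∧ (p : ℚ) = D n * c1P n ∧
      |zetaValue 5 - (c1P n : ℝ) / (c1Q n : ℝ)| < 1 / (q : ℝ) ^ γ := by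
  obtain ⟨ε, hε, hrate'⟩ : ∃ ε : ℝ, 0 < ε ∧
      γ * (lam + (114336 / 625 + ε)) < (914687 / 5000 - ε) - ((-691961 / 10000) + ε) := by
    refine ⟨(914687 / 5000 - (-691961 / 10000) - γ * (lam + 114336 / 625)) / (2 * (γ + 2)), ?_, ?_⟩
    · apply div_pos (by linarith) (by positivity)
    · have hg1 : 0 < γ + 2 := by linarith
      field_simp
      nlinarith
  have hform : ∀ᶠ n : ℕ in atTop, |(c1Q n : ℝ) * zetaValue 5 - (c1P n : ℝ)| ≤ Real.exp (((-691961 / 10000) + ε) * n) := by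
    filter_upwards [eventually_c1Form_le_exp hε, eventually_ge_atTop 1] with n hn hn1
    rwa [c1Form_eq hn1] at hn
  have hD' : ∀ᶠ n : ℕ in atTop, 0 < (D n : ℝ) ∧ (D n : ℝ) ≤ Real.exp (lam * n) := by
    filter_upwards [hD] with n hn; exact ⟨by exact_mod_cast hn.1, hn.2.2⟩
  have key := abs_sub_div_lt_of_bounds (ξ := zetaValue 5) (Q := fun n => (c1Q n : ℝ)) (P := fun n => (c1P n : ℝ))
    (D := fun n => (D n : ℝ)) hform (eventually_exp_le_abs_c1Q_sharp hε) (eventually_abs_c1Q_le_exp hε) hD' hγ hrate'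
  filter_upwards [key, hD] with n hn hDn
  obtain ⟨hDpos, ⟨z, hz⟩, -⟩ := hDn
  refine ⟨z, D n * (c1Q n).natAbs, ?_, ?_, hz.symm, ?_⟩
  · have hQ : c1Q n ≠ 0 := by
      have := (latticeTerm_le_abs_c1Q n).2
      intro h; rw [h] at this; simp at this
    exact Nat.one_le_iff_ne_zero.mpr (Nat.mul_ne_zero hDpos.ne' (Int.natAbs_ne_zero.mpr hQ))
  · simp
  · have hcast : ((D n * (c1Q n).natAbs : ℕ) : ℝ) = (D n : ℝ) * |(c1Q n : ℝ)| := by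
      push_cast; rw [Nat.cast_natAbs, Int.cast_abs]
    rw [hcast]
    exact hn

/-- With the sharp growth constant and a denominator rate `λ = 106.862` (plus32), every `γ ≤ 0.87` satisfies
the rate condition of `c1_exponent_sharp` (supremum `0.87003`; Brown–Zudilin's record worthiness is `0.86597135`). -/
theorem c1_exponent_sharp_rate_plus32 {γ : ℝ} (hγ : γ ≤ 87 / 100) :
    γ * (53431 / 500 + 1829376 / 10000) < 914687 / 5000 - ((-691961 / 10000) : ℝ) := by
  nlinarith

/-- With the sharp growth constant and a denominator rate `λ = 107.727` (lettersZ21O20), every `γ ≤ 0.8674` satisfies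
the rate condition of `c1_exponent_sharp` (supremum `0.86744`; Brown–Zudilin's record worthiness is `0.86597135`). -/
theorem c1_exponent_sharp_rate_lettersZ21O20 {γ : ℝ} (hγ : γ ≤ 4337 / 5000) :
    γ * (107727 / 1000 + 1829376 / 10000) < 914687 / 5000 - ((-691961 / 10000) : ℝ) := by
  nlinarith

/-- With the sharp growth constant and a denominator rate `λ = 109.727` (letters), every `γ ≤ 0.8615` satisfies
the rate condition of `c1_exponent_sharp` (supremum `0.86151`; Brown–Zudilin's record worthiness is `0.86597135`). -/
theorem c1_exponent_sharp_rate_letters {γ : ℝ} (hγ : γ ≤ 1723 / 2000) :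
    γ * (109727 / 1000 + 1829376 / 10000) < 914687 / 5000 - ((-691961 / 10000) : ℝ) := by
  nlinarith

end Summit.KontsevichZagierPeriods.Zeta5Search.RayC1
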